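import Mathlib
import HarnessLib
import HarnessLib.Audit
import Summits.Langlands.Statement
import Literature.NumberTheory.GaloisRepresentations.ArtinLFunction
import Literature.NumberTheory.Automorphic.AutomorphicRepsGL
import Literature.NumberTheory.GaloisRepresentations.ArtinLFunctionRatLSeriesProofs
import HarnessLib.Audit.Status.Attr

/-!
Route: EvenArtinQuantumBoundary

# Route EvenArtinQuantumBoundary — even strong Artin as quantum modularity (idea card
Langlands/Langlands/even-artin-quantum-boundary)

Thesis X (it suffices to show): QUANTUM RIGIDITY + GALOIS BOUNDARY BOUNDEDNESS. For an irreducible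
EVEN Artin representation
σ : Γ_ℚ → GL₂(ℂ) (det σ(c) = 1, conductor N, Dirichlet coefficients a_n of L(s,σ), b_n of L(s,σ^∨))
put
f(z) = Σ_{n≥1} a_n e(nz), g(z) = Σ b_n e(nz) on ℍ and the weight-one Lewis–Fricke transform ψ_N(z) =
f(z) − c z⁻¹ g(−1/(Nz)), |c| = N^{-1/2}.
Its FORMAL BOUNDARY FUNCTION on ℚ_{>0} is B(x) := D_a(0;x) − c x⁻¹ D_b(0;−1/(Nx)), where D_a(s;x) is
the meromorphic continuation of the
additive twist Σ a_n e(nx) n^{-s} (Booker 2003, Lemma 1: poles only in 0 < Re s < 1, so B is defined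
unconditionally; it is Booker's
f₀(s) at s = 0, and the radial limit of ψ_N at x whenever σ is automorphic). X says:
 (QR, QuantumRigidity) if B is locally bounded on ℚ_{>0} for some admissible c then L(s,σ) is
entire; and
 (BB, GaloisBoundaryBounded) for every irreducible even σ such a c exists (the two terms of B(b/q)
have size ≍ q; automorphy forces their difference to be O(1)).
X ⟹ EVEN ARTIN HOLOMORPHY: L(s,σ) is entire for every irreducible even σ : Γ_ℚ → GL₂(ℂ)
(GaloisBoundaryBounded supplies c and B,
QuantumRigidity concludes; the Dirichlet coefficient sequences a of σ and b of σ^∨ exist by the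
PROVED Literature theorem
FramedArtinRep.exists_LSeries_eq_artinLFunction_two, DeligneSerreASENS1974 §9, Thm. 9.1 and Cor.
9.2), whence — by Booker's converse step (Booker 2003, Corollary: a single
entire L(s,σ) ⟹ σ = π(σ); support item BookerCriterion, a vendored named fact) — the sector
corollary EvenStrongArtin := every irreducible even
σ : Γ_ℚ → GL₂(ℂ) has a cuspidal π on GL₂(𝔸_ℚ) with π = π(σ) (the definiens of the tree predicate
IsPiOfArtinRep written out — for a.e. finite place v:
Satake parameter of π at v = characteristic polynomial of arithmetic Frobenius of σ at v — so that
the route file does not import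
Automorphic.StrongArtinGL2 and its Langlands–Tunnell cone), the λ = 1/4 Maass case of conjunct (B)
(n = 2, F = ℚ, Hodge–Tate weights (0,0), det even)
that no cohomology sees (the Target, derived by the support item EvenArtinSectorGlue). The summit
`Langlands` is reached through the complement crux
OffEvenArtin : (Artin holomorphy for every irreducible even σ : Γ_ℚ → GL₂(ℂ)) → Langlands — GL_n
reciprocity in every other sector ((A) for all n and F;
(B) off the even 2-dimensional Artin slice over ℚ; the reciprocity data 𝓡_F) together with, ON the
slice, Booker's converse step (holomorphy ⟹
automorphy) and the all-places upgrade (a.e. Satake–Frobenius matching ⟹ `Corresponds` at every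
finite place, by γ-factors of GL₁-twists and the GL₂
local converse theorem) — is the route's third and last-ranked crux (open-ended, like every sector
complement): the deciding theorem assumes exactly the three
cruxes QuantumRigidity, GaloisBoundaryBounded, OffEvenArtin, and the route is judged as [even-Artin
holomorphy via QR + BB] ∧ [complement], every
open end priced as a crux.

Lean: QuantumRigidity ∧ GaloisBoundaryBounded   (both decls of this route file; one-line expansions
= the items below; all constants exist:
Literature.NumberTheory.GaloisRepresentations.{FramedArtinRep, artinLFunction,
LFunction.HasEntireContinuation, FramedRep.dual, GaloisRep.artinConductorNat,
IsComplexConjugation}, Literature.NumberTheory.Automorphic.{CuspidalAutomorphicRepData,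
AutomorphicRepData.HasSatakeParamAt, satakePolynomial, isCompact_glFiniteIntegralLevel},
Literature.NumberTheory.GaloisRepresentations.FramedGaloisRep.{IsUnramifiedAt, HasFrobCharpolyAt},
Mathlib LSeries, MeromorphicOn, AnalyticAt, IsAlgebraic;
imports = GaloisRepresentations.ArtinLFunction + Automorphic.AutomorphicRepsGL +
GaloisRepresentations.ArtinLFunctionRatLSeriesProofs (the proved
coefficient theorem invoked inside `closes`); planner Sketch.lean `lean check` rc 0, 2026-08-15 and
2026-08-16)

## Assembly
Deciding theorem (D-0027 §2.1, CRUX-ONLY, PROVED in the route file, axioms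
propext/Classical.choice/Quot.sound):
closes : QuantumRigidity → GaloisBoundaryBounded → OffEvenArtin → Langlands
(the statement item `Assembly` is the same implication as a Prop; `closes` is literally a proof of
it). Proof (pure logic): `refine hOff ?_`; for σ
irreducible even take a, b from FramedArtinRep.exists_LSeries_eq_artinLFunction_two (for σ and for
σ^∨ = FramedRep.dual σ, again a FramedArtinRep ℚ 2
definitionally); GaloisBoundaryBounded gives (c, B) with the regularised values and local bounds;
QuantumRigidity gives HasEntireContinuation
(artinLFunction σ) — the antecedent of OffEvenArtin. The sector corollary BookerCriterion →
QuantumRigidity → GaloisBoundaryBounded →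
ArtinDirichletCoefficients → EvenStrongArtin is the support item EvenArtinSectorGlue (pure logic,
provable now); ArtinDirichletCoefficients is provable now
in three lines from the same Literature theorem; the Target EvenStrongArtin is filed separately
(rank 0) so that any proof of even strong Artin closes it
and other even-Artin routes dedup against it.

Rationale: WHY THIS LINE. The even 2-dimensional Artin case over ℚ is the one slice of (B) where every
cohomological / p-adic / trace-formula engine is silent
(Literature.Barriers.Langlands.NonRegularWeightBarrier: λ = 1/4 Maass forms are L-algebraic and not
regular; Calegari2023 §12: "we do not even know how to
prove that there exists a corresponding Maass form"). This line imports the Lewis–Zagier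
period-function / quantum-modular-form picture (LewisZagier2001,
BruggemanLewisZagier2015, Bruggeman2006, Zagier2010QMF) and Booker's analysis of additive twists
(Booker2003, held and read pp. 1089–1098): at weight one
(2s = 1) the cocycle factor z⁻¹ is rational, the boundary values of the would-be period function at
every rational are special values at s = 0 of additive
twists, hence (central Brauer induction through subgroups containing c, Siegel1969/Klingen1962,
Shintani1976, DeligneRibet1980) algebraic numbers computable
from σ alone, and Booker's f₀(s) (p. 1095) is exactly the Mellin shadow of that boundary function.
Automorphy becomes a regularity statement about one
explicit arithmetic function B : ℚ_{>0} → ℚ̄; the bet (QR) is that local boundedness already forces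
coherence (entire L), the Galois side (BB) must then
supply the boundedness. Imported areas: real-analytic/quantum modular forms (dictionary: cusp values
of f ↦ additive-twist values at s = 0; period function
ψ ↦ Lewis–Fricke transform; analytic coherence ↦ entire continuation via Mellin rotation, LZ Ch. I /
Booker Lemma 2), classical special-value algebraicity
over totally real fields.
RANKED CRUXES. #3 QuantumRigidity — the honest bet: formal boundary function locally bounded ⟹
L(s,σ) entire (why it might fail: no mechanism is known
forcing poles of L(s,ρ⊗χ) in the open strip to inflate the s = 0 values; bounded-but-incoherent
Galois-born data cannot be excluded today; for arbitrary
coefficient sequences the analogous bootstrapping is false (smooth boundary data), so the Euler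
product must be used essentially). #4 GaloisBoundaryBounded —
for every irreducible even σ the regularised values exist (known: Booker Lemma 1) and some
admissible c makes B locally bounded (open; why it might fail:
the two terms of B(b/q) are each of size ≍ q^{1+o(1)} and only automorphy is known to force
cancellation; a certified computation for the conductor-1951
even icosahedral σ of DoudMoore2006 could refute it — which, given support item BoundaryNecessity,
would refute even strong Artin for that σ). #9 OffEvenArtin —
the COMPLEMENT CRUX, deliberately ranked last (route-choice 2026-08-16, option (a); crux-only form):
(Artin holomorphy for every irreducible even
σ : Γ_ℚ → GL₂(ℂ), which is exactly what QuantumRigidity ∘ GaloisBoundaryBounded deliver) →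
Langlands, i.e. ON the slice Booker's converse step holomorphy ⟹
automorphy (published: Booker2003 Cor. p. 1090, BookerKrishnamurthy2011 — the support item
BookerCriterion, vendored as
Literature.NumberTheory.Automorphic.booker_strongArtin_of_artinConjecture) and the upgrade of the
a.e. Satake–Frobenius matching to `Corresponds 𝓡 ι π ρ` for the
ℓ-adic avatar ρ = ι⁻¹σ (finite image ⟹ de Rham of Hodge–Tate weight 0; λ = 1/4 π_∞ is L-algebraic;
local–global compatibility at the ramified places from the
equality of γ-factors of all GL₁-twists and the GL₂ local converse theorem, JacquetLanglands1970
Cor. 2.19, LanglandsBaseChange1980), and OFF the slice GL_n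
reciprocity in every other sector — the reciprocity data 𝓡_F for every number field (genuine
Harris–Taylor rec_v, D_pst data above ℓ), direction (A) for every
L-algebraic cuspidal π of GL_n(𝔸_F) at every finite place, direction (B) for every irreducible
geometric ρ off the even 2-dimensional Artin slice over ℚ.
Why it might fail: it is most of the programme — (B) at irregular weight has no method beyond this
slice (even Artin in dimension ≥ 3, λ = 1/4 Maass forms over
other F), (A) for torsion-born ρ over CM fields is known only almost everywhere
(AllenCalegariCaraianiGeeEtAl2023, HarrisLanTaylorThorne2016,
Scholze2015) and not at all over general F, and the D_pst interface is placeholder-typed; it is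
implied by `Langlands` itself, so it is false iff reciprocity
fails somewhere. It is expected to close only by conjunction of the other sector routes' theorems
(it is the junction every even-Artin line shares); staffing
it from this route before QR/BB move would be misdirected, which the rank records. BookerCriterion
(the NAMED FACT the sector corollary rests on: Booker2003
Cor., p. 1090, for irreducible ρ : Γ_ℚ → GL₂(ℂ), L(s,ρ) entire ⟹ ρ automorphic; retriaged
crux→support 2026-08-15; why it might fail: only by transcription —
'automorphic' vs the IsPiOfArtinRep shape, finite-part L-function = tree artinLFunction) is since
2026-08-16 NOT a hypothesis of the deciding theorem: Booker's
step sits inside the complement crux, and BookerCriterion stays as the vendored statement through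
which the Target EvenStrongArtin follows
(support item EvenArtinSectorGlue), so `closes` assumes cruxes only and carries no named fact.
KILL CRITERIA. (i) A certified computation showing B unbounded along Farey fractions for some
irreducible even σ and EVERY unit multiple c of N^{-1/2}
refutes BB and (with BoundaryNecessity) the Target — route closed refuted, summit-level negative
knowledge. (ii) An irreducible even σ (or a structural
argument inside the Artin class) with bounded B but a provable pole refutes QR: close. (iii) If the
PHANTOM test (see CHEAPEST FALSIFIER) shows bounded
boundary data for a virtual character with poles, QR's mechanism is void even if its Lean statement
survives: pivot to the p-adic form of QR (Wiles1990
holomorphy of p-adic L-functions of even σ as the extra hypothesis) or close exhausted. (iv)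
BookerCriterion cannot die (published theorem); a bounce only
fixes conventions. (v) OffEvenArtin can die only with reciprocity itself (a refutation would be a
counterexample to Fontaine–Mazur–Langlands
off the slice — summit-level negative knowledge closing every route of this summit); it does not
bear on the line's own bets.
NOT DECOMPOSED YET. How QR could be proved (Farey/three-term recursion of the SL₂(ℤ)-induced
vector-valued period function with Mühlenbruch's rational
Hecke matrices; p-adic interpolation of the jets D_a(−k;x) by Iwasawa-analytic functions,
DeligneRibet1980 + Wiles1990; an adelic 'continuity in all
topologies ⟹ archimedean analyticity' principle); the dihedral rung (σ = Ind from a real quadratic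
field: prove BB ∧ QR directly from the Shintani/Sczech
Eisenstein cocycle — a Galois-side proof of Maass 1949 — as the template); the totally real
base-field version; the GL₂ local converse bookkeeping inside
BoundaryNecessity. All of these become glued splits (≤ 3 children) only after #4 has numerical
support.
CHEAPEST FALSIFIER. kit-sized: for the even icosahedral σ of prime conductor 1951 (DoudMoore2006 p.
62) compute L(0, σ⊗χ), L(0, σ^∨⊗χ) for all Dirichlet
χ of conductor q ≤ 60 (PARI lfunartin or exact Shintani cone sums), assemble D_a(0; b/q), D_b(0;
−q/(1951 b)) and plot max_{b} |B(b/q)| against q for the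
finitely many candidate c = η·1951^{-1/2} suggested by the root number: growth ≍ q kills BB (or
exposes a bookkeeping error — run the SAME script first on a
known even octahedral/tetrahedral σ, where BoundaryNecessity predicts O(1)). Second cheapest (kills
the mechanism of QR): the same plot for the virtual
A₅-character ρ₃ + ρ₃' − ρ₄ of a totally real A₅-field (degree-2 'phantom': locally effective on
every cyclic subgroup, GL₂-type Euler factors, FE and
algebraic special values, but L = L(ρ₃)L(ρ₃')/L(ρ₄) has poles): QR predicts UNBOUNDED data there.
TWO-LAYER PLAN. Layer 1 = three cruxes (QR, BB, and the complement OffEvenArtin ranked last —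
exactly the hypotheses of `closes`) + Target + five support
items (BookerCriterion, ArtinDirichletCoefficients, BoundaryNecessity, BoundaryValuesAlgebraic, and
the pure-logic sector glue EvenArtinSectorGlue :
BookerCriterion → QuantumRigidity → GaloisBoundaryBounded → ArtinDirichletCoefficients →
EvenStrongArtin, provable now) + Assembly (a Prop of the same shape as,
and proved verbatim by, the deciding theorem `closes : QuantumRigidity → GaloisBoundaryBounded →
OffEvenArtin → Langlands`) (10 items ≤ 15). Layer 2 (after a
crux closes): QR ⇐ [QR_Farey: bounded Hecke-eigen solutions of the rational three-term system on the
Farey tree are restrictions of real-analytic solutions] +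
[Fricke-to-Farey transfer]; BB ⇐ [size and Galois-equivariance of D_a(0;b/q) via central Brauer] +
[cancellation lemma]. Lemmas below that ride with --supports.
NUMBERS. Minimal prime conductor of an even icosahedral σ over ℚ: 1951 (DoudMoore2006, Hunter
search; six primes < 10⁴). First Maass cusp form on SL₂(ℤ):
λ ≈ 91.14 > 1/4 (no level-1 test case; all tests are at level N > 1). Size heuristic: |L(0,σ⊗χ)| ≍
(N q²)^{1/2}|L(1,σ^∨⊗χ̄)| ≍ q N^{1/2} (log)^{O(1)}.
SOURCES. Booker2003 (held: paper:doi-10-4007-annals-2003-158-1089, Theorem + Corollary p. 1090,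
Lemma 1 p. 1092, f₀ p. 1095, odd case p. 1097);
LewisZagier2001 (doi:10.2307/2661374; arXiv text extraction unusable this session — statements used
only via Zagier2010QMF pp. 28–29, held
paper:galaxy-pdf-4590193843102524780, and BruggemanLewisZagier2015); Bruggeman2006; BettinConrey2013
(Eisenstein analogue: a_n = d(n), boundary values =
cotangent sums, ψ extends to ℂ'); Nordentoft2021 and arXiv:2208.14346 (additive twists of cusp forms
are quantum modular — automorphic-to-quantum direction);
DoudMoore2006; Siegel1969, Klingen1962, Shintani1976, DeligneRibet1980, Wiles1990;
KhareWintenberger2009 (odd case, for contrast); Calegari2023 §12;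
tree: Literature.NumberTheory.Automorphic.BookerStrongArtin (booker_strongArtin_of_artinConjecture =
Booker2003 Cor. p. 1090; booker_additiveTwist_meromorphic =
Booker2003 Lemma 1 p. 1092 — cited, deliberately NOT imported), Automorphic.AutomorphicRepsGL
(CuspidalAutomorphicRepData, HasSatakeParamAt, satakePolynomial),
Automorphic.StrongArtinGL2 only for the wording of IsPiOfArtinRep / strongArtin_of_isSolvable
(module NOT imported), SolvableImageBarrier(.Narrow).
DEFINITION REQUESTS. (1) FramedGaloisRep.IsEven (parity predicate dual to the accepted IsOdd); (2)
additive-twist regularised value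
`LSeries.addTwistValue a x s₀` (value at s₀ of the meromorphic continuation of Σ a_n e(nx) n^{-s})
in Literature/NumberTheory/LFunctions — would shorten
QR/BB/BoundaryNecessity/BoundaryValuesAlgebraic; (3) later: weight-one period-function module
(three-term equation at 2s = 1), shared with card
rational-period-functions-quarter.
SUPPORT. ArtinDirichletCoefficients (routine and PROVABLE NOW in three lines: `obtain ⟨a, -, -, -,
hbd, ha⟩ :=
FramedArtinRep.exists_LSeries_eq_artinLFunction_two σ; exact ⟨a, hbd, fun s hs => (ha s hs).2⟩` —
planner Sketch.lean 2026-08-16, lean rc 0, axioms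
propext/Classical.choice/Quot.sound; no longer needed by `closes`, which invokes the Literature
theorem directly); BookerCriterion (vendored named fact, see RANKED
CRUXES; provers: do not attempt a proof); EvenArtinSectorGlue (pure logic, provable now);
BoundaryNecessity (automorphic ⟹ ∃ c, B locally bounded: LZ/BLZ integral
representation of ψ_N between the cusps 0 and ∞ + Bruggeman's quantum Maass forms + newform/Fricke
theory; it is what makes a numerical refutation of BB bite);
BoundaryValuesAlgebraic (Siegel–Klingen via central Brauer: the 'Galois-computable' pillar).
DEGENERATE CASES CHECKED. Odd σ: all D_a(−k;x) vanish (Γ_ℂ trivial zeros, Booker p. 1097) so B ≡ 0 —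
QR is therefore restricted to EVEN σ (else it
would assert odd Artin = KhareWintenberger2009 for free). Reducible σ excluded by irreducibility
(Eisenstein data have a pole at s = 1 and unbounded
cotangent-sum boundary values, BettinConrey2013 — consistent with QR). Level 1 is empty (no λ = 1/4
cusp forms on SL₂(ℤ)). Virtual characters are not
FramedArtinReps, so the phantom cannot instantiate the Lean statements; it tests the mechanism only.
Sign conventions: lower-half-plane continuation
f⁻(z) = −ε Σ a_n e(−nz) and |c| = N^{-1/2} were derived by the planner from the Mellin rotation
(even: tan(πs/2), odd: cot(πs/2) factor) and match
Booker's f₀; the Lean items avoid ψ and the lower half-plane entirely (B is defined by special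
values), so only the pairing x ↔ −1/(Nx), the factor x⁻¹
and |c| are load-bearing.
IMPORT CONE (route-repair 2026-08-15). The route file imports only
Literature.NumberTheory.GaloisRepresentations.ArtinLFunction (FramedArtinRep, artinLFunction,
LFunction.HasEntireContinuation, FramedRep.dual; transitively ArtinConductor for
GaloisRep.artinConductorNat and AbsGaloisGroup for IsComplexConjugation) and
Literature.NumberTheory.Automorphic.AutomorphicRepsGL (CuspidalAutomorphicRepData,
AutomorphicRepData.HasSatakeParamAt, satakePolynomial,
isCompact_glFiniteIntegralLevel — already inside the cone of Summits.Langlands.Statement via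
ReciprocityGLn). Automorphic.StrongArtinGL2 was dropped: it dragged
LanglandsTunnell(Proofs), EllipticCurves.NewformGaloisRep,
GaloisRepresentations.ArtinLFunctionProofs → LFunctions.DedekindZeta into the cone, i.e. the named
facts strongArtin_of_isSolvable / _isDihedralType / _isTetrahedralType / _isOctahedralType,
exists_isNewform1_of_isPiOfArtinRep,
frobSatakeCompatibleAt_of_isPiOfArtinRep, DeligneSerre1974.thm46a_artinConductorNat_eq,
exists_complexGaloisRep_of_weight_one,
exists_weierstrassCurve_of_rational_isNewform0, exists_padicGaloisRep_of_isNewform1,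
(NumberField.)ExtendedRiemannHypothesis(') — NONE of which is
load-bearing here (Booker's Corollary as printed covers every irreducible type, the solvable ones
through Langlands–Tunnell inside the citation);
GaloisRep.natCast_localArtinConductor merely shares the module of artinConductorNat and is not used.
Declaration cone of the items + `closes`
(#h21_route_deps, 336 constants): the only closed named facts are those inherited from `Langlands`
itself and from artinLFunction's arithmetic Frobenius
(isOpen_ker_quasiChar, exists_isFrobPow, IsFrobPow.mul, IsFrobPow.unique,
WeilGroup.exists_subgroup_le_inertia_isOpen_of_continuous) — summit-level debt
shared by every Langlands route. GENUINELY NEEDED published results, recorded as debt: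
needs-fact: Literature.NumberTheory.Automorphic.booker_strongArtin_of_artinConjecture (Booker2003
Corollary p. 1090; ≡ item BookerCriterion verbatim — a
proof of either closes the other by `Iff.rfl`).
needs-fact: Literature.NumberTheory.Automorphic.booker_additiveTwist_meromorphic (Booker2003 Lemma 1
p. 1092; = part (i) of GaloisBoundaryBounded and the
D-witnesses consumed by QuantumRigidity / BoundaryNecessity / BoundaryValuesAlgebraic at k = 0;
shape-checked by
exists_regularisedValue_of_booker_additiveTwist_meromorphic in that module).
IMPORT CONE UPDATE (2026-08-16). Third import
Literature.NumberTheory.GaloisRepresentations.ArtinLFunctionRatLSeriesProofs (pure proofs; its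
theorem
FramedArtinRep.exists_LSeries_eq_artinLFunction_two — Dirichlet coefficients of L(s,σ) for σ : Γ_ℚ →
GL₂(ℂ), |a_n| ≤ d(n), DeligneSerreASENS1974 §9 — is invoked
inside `closes`; `#print axioms` of the resulting deciding theorem: propext, Classical.choice,
Quot.sound, so the used-constants cone stays free of unproved facts).
ROUTE-CHOICE (operator hold 2026-08-16T02:41Z; options offered: (a) add the open complement as a
crux | (b) bank the sector theorem + close
exhausted-with-result). CHOSEN AND CARRIED OUT: (a), in crux-only form. The complement of what the
line itself delivers (Artin holomorphy on the even
two-dimensional slice over ℚ) is ONE crux of the route, OffEvenArtin : (holomorphy on the slice) →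
Langlands (kind crux, rank 9, why-it-might-fail + sources), and the
deciding theorem assumes exactly the three cruxes: closes : QuantumRigidity → GaloisBoundaryBounded
→ OffEvenArtin → Langlands (Dirichlet coefficients from the
proved Literature theorem inside the proof; no support item, no named fact, no target among the
hypotheses). So the route encompasses the entire summit as
[Artin holomorphy on the slice via QR + BB] ∧ [OffEvenArtin], with every uncertain end priced as a
crux — the shape the obligation-graph rule
sanctions ('bridge X ⇒ S inside a route iff X and the complementary sector are cruxes'). Why not
(b): nothing unconditional beyond pure-logic glue is proved on
this route yet (QR, BB open), so banking would record a vacuous result and retire a vetted,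
cone-clean line whose cheapest falsifier is kit-sized. The sector
corollary even strong Artin (Target EvenStrongArtin) remains derivable inside the route through the
support items BookerCriterion (Booker2003 Cor., vendored) and
EvenArtinSectorGlue. History: rev 3 (2026-08-16T03:09Z) first restated OffEvenArtin as
`EvenStrongArtin → Langlands` with `closes` taking five hypotheses
(BookerCriterion, QR, BB, ArtinDirichletCoefficients, OffEvenArtin); rev 4 added
EvenArtinSectorGlue; the crux-only deciding-theorem rule (2026-08-16) then
flagged the two support hypotheses, and rev 7 (2026-08-16T04:28Z) moved Booker's converse step into
the complement crux and the coefficient lemma into the proof term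
(planner Sketch.lean: new `closes`, `ArtinDirichletCoefficients` in three lines, old-Assembly
compatibility and OffEvenArtin_new ⇐ OffEvenArtin_old ∘
BookerCriterion all lean rc 0, axioms propext/Classical.choice/Quot.sound); gen 5
(2026-08-16T04:50Z) re-verified the finished state — preview render
byte-identical to rev 7 but for the nonce, #h21_check_closes ok (hypotheses = the three cruxes,
non_crux [], axioms standard) — and reworded two header
phrases and the `closes` docstring (text only; no item, kind, rank, statement or proof change).

Novelty: Searches run 2026-08-15 (local lit index daemon unreachable this session; remote zbMATH/crossref +
galaxy used): zbmath "Period functions for Maass wave forms Lewis Zagier"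
(LewisZagier2001 doi:10.2307/2661374, BruggemanLewisZagier2015 doi:10.1090/memo/1118, Deitmar 2011,
Hilgert–Mayer–Movasati 2005), zbmath "Quantum Maass forms Bruggeman" (zbl:1130.11019 =
Bruggeman2006), zbmath "additive twists Maass form quantum modular" (Drappeau–Nordentoft
arXiv:2208.14346), zbmath "cotangent sums period functions Bettin Conrey" (BettinConrey2013
doi:10.2140/ant.2013.7.215), zbmath "quantum modular form Artin representation" (nothing relevant),
zbmath "even Galois representation Maass form eigenvalue 1/4 period function" (0 hits),
crossref/zbmath "Poles of Artin L-functions strong Artin conjecture" (Booker2003, read in full),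
galaxy --star all "Period functions for Maass wave forms" (Möller–Pohl arXiv:1103.5235,
Bruggeman math/9508202, Mühlenbruch math/0408309, BLZ 'Function theory related to PSL2(R)'), zbmath
"Even icosahedral Galois representations prime conductor" (DoudMoore2006). Plus the
card's own audited search (refuter-novelty-audit 2026-08-15: grade new-combination). NEAREST PRIOR
ART FOUND: (A) Booker2003 — the additive twists L(s,ρ,α), their meromorphy (Lemma 1) and
the difference f₀(s) pairing α with −1/(Nα) (p. 1095) are all there, used to show 'one entire twist
⟹ automorphic'; (B) LewisZagier2001/BruggemanLewisZagier2015/Bruggeman2006/Zagier2010QMF —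
Maass form ⟺ period fun  [refs: 10.2307/2661374, 10.1090/memo/1118, 10.2140/ant.2013.7.215, 2208.14346, 1103.5235, doi:10.2307/2661374, doi:10.1090/memo/1118, doi:10.2140/ant.2013.7.215, LewisZagier2001, BruggemanLewisZagier2015, Bruggeman2006, BettinConrey2013, Booker2003, DoudMoore2006, Nordentoft2021]

Barriers (technique_class: quantum-modular lewis-zagier additive-twist brauer-induction): - technique_class: quantum-modular lewis-zagier additive-twist brauer-induction
- Literature.Barriers.Langlands.NonRegularWeightBarrier: evaded, not met — no coefficient system, no
cohomology of a locally symmetric space, no eigenvariety; the singular infinity type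
maassQuarterInfinityType enters only as the exponent 2s = 1 of the cocycle factor z⁻¹, which is
exactly what makes the boundary values algebraic (Siegel–Klingen at s = 0) instead of transcendental
periods.
- Literature.Barriers.Langlands.SolvableImageBarrier: evaded in the only honest way for insoluble
(icosahedral) images — no base change, descent or automorphic induction is used to TRANSFER
automorphy; Brauer induction (indifferent to im ρ, as the barrier's scope_caveat (2) records) is
used only to continue and evaluate L-functions, where virtual expressions are harmless because
values multiply; automorphy comes from Booker's converse-type theorem once entirety is known. The
bet is QR; SolvableImageBarrierNarrow's index-5 tetrahedral restriction is not used either (it is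
inside Booker's own proof).
- Literature.Barriers.Langlands.ShimuraVarietyRealizationBarrier: not engaged (no Shimura variety,
no coherent cohomology; the would-be Maass form is touched only through its L-function and boundary
function).
- Literature.Barriers.Langlands.TaylorWilesNumericalCoincidence, PatchingLocalComponentBarrier,
ResiduallyReducibleBarrier, TwistedEndoscopySelfDual, ModPLanglandsGL2BeyondQp,
ShtukaConstantFieldBarrier: not enga

History (route lifecycle, newest last):
- 2026-08-16T02:17:47Z · AUTO-CRUX: 2 conjecture-grade item(s) promoted to crux (EvenStrongArtin, OffEvenArtin) — refuter vetting / tiering apply (operator:999:1362873)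
- 2026-08-16T03:09:18Z · rev 3: restated OffEvenArtin (stmt-Langlands-3317) — route-choice (partial-claim hold 2026-08-16T02:41Z): option (a) — the open complement becomes a CLAIMED crux. OffEvenArtin restated 1:1 (same decl name; Assembl (planner-rchoice-Langlands-EvenArtinQuantumBoun-a85ab51b-0)
- 2026-08-16T03:22:49Z · rev 4: restated EvenArtinSectorGlue (stmt-Langlands-14231) — route-choice follow-up: restate the support item EvenArtinSectorGlue (stmt-Langlands-14231) — the rev-3 render placed it before ArtinDirichletCoefficients and c (planner-rchoice-Langlands-EvenArtinQuantumBoun-a85ab51b-0)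
- 2026-08-16T04:28:04Z · rev 7: restated OffEvenArtin (stmt-Langlands-14230), Assembly (stmt-Langlands-3318) — route-choice (a), crux-only form: complement crux OffEvenArtin restated 1:1 (same decl name, kind crux, rank 9) as (Artin holomorphy for every irreducible even (planner-rchoice-Langlands-EvenArtinQuantumBoun-a85ab51b-g4-0)
- 2026-08-22T13:59:38Z · DORMANT — reconciler: no traction for 5.4 d (last activity item-evidence-added at 2026-08-17T04:10:59Z); parked, not closed — `ledger route dormant route-Langlands-EvenAr (operator:999:2386172)
- 2026-09-01T04:13:46Z · REACTIVATED (open) — reconciler: reactivated — activity item-proof-filed at 2026-09-01T03:11:11Z after parking at 2026-08-22T13:59:38Z (operator:999:2056456)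

sub-problem: Langlands · status: open · opened planner-plancard-Langlands-Langlands-even-art-7dcbeba8-0 2026-08-15T11:16:25Z · rev 8 · ledger route-Langlands-EvenArtinQuantumBoundary
GENERATED by the gate from the ledger (D-0016/17). Provers cite these decls: `theorem foo : Summit.Langlands.Langlands.Theses.EvenArtinQuantumBoundary.<Decl> := …` in Summits/Langlands/Langlands/Theorems/<Name>.lean.
-/

namespace Summit.Langlands.Langlands.Theses.EvenArtinQuantumBoundary

open scoped BigOperators Topology Manifold Classical MeasureTheory ProbabilityTheory Matrix InnerProductSpace ComplexConjugate ContinuousMap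
open Filter Set Function TopologicalSpace MeasureTheory

attribute [summit_statement] _root_.Langlands

/-- item stmt-Langlands-3310 · target · rank 0 · open · by planner
why it might fail: Open problem (even icosahedral strong Artin over Q: Calegari2023 §12; Booker2003 p.1090 'no known examples in the even case'); false iff some irreducible even σ has non-entire L(s,σ) — then infinitely many poles (Booker2003 Thm); no candidate known; smallest test conductor 1951 (DoudMoore2006).
sources: Calegari2023, Booker2003, DoudMoore2006, KhareWintenberger2009, Literature.NumberTheory.Automorphic.booker_strongArtin_of_artinConjecture, Literature.NumberTheory.Automorphic.strongArtin_of_isSolvable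
[target] EVEN STRONG ARTIN OVER ℚ: every irreducible σ : Γ_ℚ → GL₂(ℂ) with det σ(c) = 1 for complex
conjugation c (equivalently σ(c) = ±I is central; the splitting field is totally real if σ(c) = I
and CM with central complex conjugation if σ(c) = −I) has a cuspidal automorphic π on GL₂(𝔸_ℚ) with
π = π(σ) a.e. (IsPiOfArtinRep, same shape as the tree's strongArtin_of_isDihedralType).
Conjecturally π_∞ = λ = 1/4 principal series (Maass newform of eigenvalue exactly 1/4, even/odd as
σ(c) = +I/−I). Known for solvable projective image (Literature strongArtin_of_isSolvable,
Langlands–Tunnell); OPEN for icosahedral image (Calegari2023 §12; first example conductor 1951,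
DoudMoore2006). This is the slice of conjunct (B) of GlobalLanglandsCorrespondenceGLn (n = 2, F = ℚ,
ℓ-adic avatar of σ is geometric with Hodge–Tate weights (0,0)) that NonRegularWeightBarrier leaves
to non-cohomological methods. What X = QuantumRigidity ∧ GaloisBoundaryBounded buys via
BookerCriterion. why it might fail: it is a case of Langlands reciprocity; fails iff some even
icosahedral σ has non-entire L(s,σ) (Booker2003: then infinitely many poles). [difficulty:
open-problem] -/
@[route_item "route-Langlands-EvenArtinQuantumBoundary"]
def EvenStrongArtin : Prop :=
  ∀ σ : Literature.NumberTheory.GaloisRepresentations.FramedArtinRep ℚ 2, σ.toGaloisRep.IsIrreducible → (∀ (φ : ℚ →+* ℝ) (c : Field.absoluteGaloisGroup ℚ), Literature.NumberTheory.GaloisRepresentations.IsComplexConjugation φ c → Matrix.GeneralLinearGroup.det (σ c) = 1) → ∃ (hcpt : Literature.NumberTheory.Automorphic.isCompact_glFiniteIntegralLevel 2 ℚ) (P : Literature.NumberTheory.Automorphic.CuspidalAutomorphicRepData 2 ℚ hcpt), (∀ᶠ v : IsDedekindDomain.HeightOneSpectrum (NumberField.RingOfIntegers ℚ) in Filter.cofinite,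 ∃ α : Multiset ℂ, Literature.NumberTheory.Automorphic.AutomorphicRepData.HasSatakeParamAt P.1 v α ∧ Literature.NumberTheory.GaloisRepresentations.FramedGaloisRep.IsUnramifiedAt v σ ∧ Literature.NumberTheory.GaloisRepresentations.FramedGaloisRep.HasFrobCharpolyAt v (Literature.NumberTheory.Automorphic.satakePolynomial α) σ)

/-- item stmt-Langlands-3312 · crux · rank 3 · open · by planner
why it might fail: B sees only the s=0 constant terms at the cusps, while a pole s0∈(0,1) of L(s,σ⊗χ) enters f(x+iy) as y^(-s0) (Booker2003 (2)-(4), Lemma 4): invisible to B. No mechanism links them, so QR (implied by Artin, unrefutable alone) may be unprovable this way; for non-Euler data bounded ⟹ analytic is false.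
sources: Booker2003, paper:doi-10-4007-annals-2003-158-1089 p3-p4 (eqs. (2)-(4), Lemma 1), p7 (Lemma 4, f0, p.1095), LewisZagier2001, BruggemanLewisZagier2015, Zagier2010QMF, Bruggeman2006
[crux] QUANTUM RIGIDITY (the bet; card lever (3)(b) in Booker's additive-twist language). For
irreducible even σ with coefficient sequences a (of σ) and b (of σ^∨), conductor N =
artinConductorNat, and a constant c with |c| = N^{-1/2}: let B : ℚ_{>0} → ℂ be the FORMAL BOUNDARY
FUNCTION of the weight-one Lewis–Fricke transform ψ_N(z) = f(z) − c z⁻¹ g(−1/(Nz)) (f = Σ a_n e(nz),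
g = Σ b_n e(nz)), i.e. B(x) = D_a(0;x) − c x⁻¹ D_b(0;−1/(Nx)) with D_a(s;x) the meromorphic
continuation of Σ_{n≥1} a_n e(nx) n^{-s} (exists, poles only in 0 < Re s < 1: Booker2003 Lemma 1; =
Booker's f₀(0), p. 1095; = radial limit of ψ_N at x if σ is automorphic). CLAIM: if B is bounded on
every ℚ ∩ [1/(m+2), m+2] then L(s,σ) has entire continuation. Intended proof shape (NOT decomposed):
boundedness + Euler product + FE of all twists ⟹ ψ_N extends holomorphically to ℂ∖(−∞,0] with
tempered growth ⟹ (Mellin rotation between the rays ±i ℝ_{>0}, lower half-plane f⁻(z) = −ε Σ a_n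
e(−nz); LewisZagier2001 Ch. I / Booker2003 Lemma 2) Λ(s,σ) entire with its
tan(πs/2)/cot(πs/2)-twisted FE. why it might fail: see why_might_fail; also the statement is only as
strong as 'bounded'; the true hypothesis may need jet coheren -/
@[route_item "route-Langlands-EvenArtinQuantumBoundary", crux]
def QuantumRigidity : Prop :=
  ∀ (σ : Literature.NumberTheory.GaloisRepresentations.FramedArtinRep ℚ 2) (a b : ℕ → ℂ) (c : ℂ) (B : ℚ → ℂ), σ.toGaloisRep.IsIrreducible → (∀ (φ : ℚ →+* ℝ) (c : Field.absoluteGaloisGroup ℚ), Literature.NumberTheory.GaloisRepresentations.IsComplexConjugation φ c → Matrix.GeneralLinearGroup.det (σ c) = 1) → (∀ s : ℂ, 1 < s.re → LSeries a s = Literature.NumberTheory.GaloisRepresentations.artinLFunction σ.toArtinRep s) → (∀ s : ℂ, 1 < s.re → LSeries b s = Literature.NumberTheory.GaloisRepresentations.artinLFunction (Literature.NumberTheory.GaloisRepresentations.FramedArtinRep.toArtinRep (Literature.NumberTheory.GaloisRepresentations.FramedRep.dual σ)) s) → ‖c‖ = ((Literature.NumberTheory.GaloisRepresentations.GaloisRep.artinConductorNat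 σ.toGaloisRep : ℕ) : ℝ) ^ (-(1 / 2 : ℝ)) → (∀ x : ℚ, 0 < x → ∃ u v : ℂ, (∃ D : ℂ → ℂ, MeromorphicOn D Set.univ ∧ AnalyticAt ℂ D 0 ∧ D 0 = u ∧ ∀ s : ℂ, 1 < s.re → D s = LSeries (fun n : ℕ => a n * Complex.exp (2 * Real.pi * Complex.I * (n : ℂ) * ((x : ℚ) : ℂ))) s) ∧ (∃ D : ℂ → ℂ, MeromorphicOn D Set.univ ∧ AnalyticAt ℂ D 0 ∧ D 0 = v ∧ ∀ s : ℂ, 1 < s.re → D s = LSeries (fun n : ℕ => b n * Complex.exp (2 * Real.pi * Complex.I * (n : ℂ) * (((-1 / ((Literature.NumberTheory.GaloisRepresentations.GaloisRep.artinConductorNat σ.toGaloisRep : ℕ) * x)) : ℚ) : ℂ))) s) ∧ B x = u - c * ((x : ℚ) : ℂ)⁻¹ * v) → (∀ m : ℕ, ∃ M : ℝ, ∀ x : ℚ, (1 : ℚ) / (m + 2) ≤ x → x ≤ m + 2 → ‖B x‖ ≤ M) → Literature.NumberTheory.GaloisRepresentations.LFunction.HasEntireContinuation (Literature.NumberTheory.GaloisRepresentations.artinLFunction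 σ.toArtinRep)

/-- item stmt-Langlands-3313 · crux · rank 4 · open · by planner
why it might fail: At x=b/q each term of B is ≍ q^(1+o(1)) (FE: |L(0,σ⊗χ)| = A^(1/2)π^(-2)|L(1,σ^∨⊗χ̄)| ≍ qN^(1/2)); only automorphy (BoundaryNecessity) is known to force the difference O(1). Certified numerics for the conductor-1951 even icosahedral σ (DoudMoore2006) showing growth in q refute it.
sources: Booker2003, paper:doi-10-4007-annals-2003-158-1089 p4 (Lemma 1, p.1092), p7 (f0, p.1095), DoudMoore2006, Bruggeman2006, LewisZagier2001, BruggemanLewisZagier2015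
[crux] GALOIS BOUNDARY BOUNDEDNESS (card lever (3)(a), the computable shadow). For every irreducible
even σ with coefficient sequences a, b of σ, σ^∨: (i) for every rational x > 0 the additive twists Σ
a_n e(nx) n^{-s} and Σ b_n e(−n/(Nx)) n^{-s} continue meromorphically to ℂ and are analytic at s = 0
(KNOWN: Booker2003 Lemma 1 — finite combinations of L(s,σ⊗χ) with entire corrections; no pole at 0
or 1 since σ⊗χ is irreducible non-trivial); (ii) OPEN: for some c with |c| = N^{-1/2} (expected c =
η N^{-1/2}, η the Fricke/root-number phase, sign (−1)^a as in Booker's f₀) the boundary function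
B(x) = D_a(0;x) − c x⁻¹ D_b(0;−1/(Nx)) is bounded on each ℚ ∩ [1/(m+2), m+2]. Each term has size ≍
q^{1+o(1)} at x = b/q (FE: |L(0,σ⊗χ)| ≍ (Nq²)^{1/2}|L(1,σ^∨⊗χ̄)|); automorphy forces the difference
to be O(1) (support BoundaryNecessity), nothing else is known to. Values are algebraic (support
BoundaryValuesAlgebraic), so the statement is exactly computable for the conductor-1951 even
icosahedral σ (DoudMoore2006) — see CHEAPEST FALSIFIER. [difficulty: open-problem; numerically
testable] -/
@[route_item "route-Langlands-EvenArtinQuantumBoundary", crux]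
def GaloisBoundaryBounded : Prop :=
  ∀ (σ : Literature.NumberTheory.GaloisRepresentations.FramedArtinRep ℚ 2) (a b : ℕ → ℂ), σ.toGaloisRep.IsIrreducible → (∀ (φ : ℚ →+* ℝ) (c : Field.absoluteGaloisGroup ℚ), Literature.NumberTheory.GaloisRepresentations.IsComplexConjugation φ c → Matrix.GeneralLinearGroup.det (σ c) = 1) → (∀ s : ℂ, 1 < s.re → LSeries a s = Literature.NumberTheory.GaloisRepresentations.artinLFunction σ.toArtinRep s) → (∀ s : ℂ, 1 < s.re → LSeries b s = Literature.NumberTheory.GaloisRepresentations.artinLFunction (Literature.NumberTheory.GaloisRepresentations.FramedArtinRep.toArtinRep (Literature.NumberTheory.GaloisRepresentations.FramedRep.dual σ)) s) → ∃ (c : ℂ) (B : ℚ → ℂ), ‖c‖ = ((Literature.NumberTheory.GaloisRepresentations.GaloisRep.artinConductorNat σ.toGaloisRep : ℕ) : ℝ) ^ (-(1 / 2 : ℝ)) ∧ (∀ x : ℚ, 0 < x → ∃ u v : ℂ, (∃ D : ℂ → ℂ, MeromorphicOn D Set.univ ∧ AnalyticAt ℂ D 0 ∧ D 0 = u ∧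 ∀ s : ℂ, 1 < s.re → D s = LSeries (fun n : ℕ => a n * Complex.exp (2 * Real.pi * Complex.I * (n : ℂ) * ((x : ℚ) : ℂ))) s) ∧ (∃ D : ℂ → ℂ, MeromorphicOn D Set.univ ∧ AnalyticAt ℂ D 0 ∧ D 0 = v ∧ ∀ s : ℂ, 1 < s.re → D s = LSeries (fun n : ℕ => b n * Complex.exp (2 * Real.pi * Complex.I * (n : ℂ) * (((-1 / ((Literature.NumberTheory.GaloisRepresentations.GaloisRep.artinConductorNat σ.toGaloisRep : ℕ) * x)) : ℚ) : ℂ))) s) ∧ B x = u - c * ((x : ℚ) : ℂ)⁻¹ * v) ∧ (∀ m : ℕ, ∃ M : ℝ, ∀ x : ℚ, (1 : ℚ) / (m + 2) ≤ x → x ≤ m + 2 → ‖B x‖ ≤ M)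

-- earlier OffEvenArtin (stmt-Langlands-14230, replaced 2026-08-16T04:28:04Z -> stmt-Langlands-14673): retired by None — EvenStrongArtin → _root_.Langlands
-- earlier OffEvenArtin (stmt-Langlands-3317, replaced 2026-08-16T03:09:18Z -> stmt-Langlands-14230): retired by None — (∀ σ : Literature.NumberTheory.GaloisRepresentations.FramedArtinRep ℚ 2, σ.toGaloisRep.IsIrreducible → (∀ (φ : ℚ →+* ℝ) (c : Field.absoluteGaloisGroup ℚ), Literature.NumberTheory.GaloisRepresentations.IsComplexConjugation φ c → Matrix.GeneralLinearGroup.det (σ c) = 1) → ∃ (hcpt : Li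
/-- item stmt-Langlands-14673 · crux · rank 9 · open · by planner
why it might fail: Most of GL_n reciprocity plus Booker's converse step on the slice: (B) at irregular weight has no method off this slice; (A) for torsion-born ρ known only a.e. over CM (ACCGHLNSTT 2023), not over general F; D_pst placeholder-typed. Implied by Langlands: false iff reciprocity fails somewhere.
sources: BuzzardGeeLMS2014, FontaineMazurGeometric1995, Calegari2023, AllenCalegariCaraianiGeeEtAl2023, HarrisLanTaylorThorne2016, Scholze2015
[crux] COMPLEMENT CRUX (claimed; deliberately ranked last; crux-only form, route-choice 2026-08-16
option (a)): Artin holomorphy on the even two-dimensional slice over ℚ — L(s,σ) entire (tree: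
LFunction.HasEntireContinuation of the finite-part artinLFunction) for every irreducible σ : Γ_ℚ →
GL₂(ℂ) with det σ(c) = 1 at complex conjugation, which is exactly what QuantumRigidity ∘
GaloisBoundaryBounded deliver — ⟹ the summit `Langlands`. Content, listed honestly: (o) ON the
slice, Booker's converse step holomorphy ⟹ automorphy (published: Booker2003 Cor. p. 1090,
BookerKrishnamurthy2011; = the support item BookerCriterion, vendored as
Literature.NumberTheory.Automorphic.booker_strongArtin_of_artinConjecture) and the upgrade of the
resulting a.e. Satake–Frobenius matching to `Corresponds 𝓡 ι π ρ` for the ℓ-adic avatar ρ = ι⁻¹σ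
(finite image ⟹ de Rham with Hodge–Tate weights 0; λ = 1/4 π_∞ is L-algebraic; local–global
compatibility at the ramified places from γ-factors of all GL₁-twists + the GL₂ local converse
theorem, JacquetLanglands1970 Cor. 2.19, LanglandsBaseChange1980); (i) reciprocity data 𝓡_F for
every number field F (genuine Harris–Taylor rec_v at every finite place, HarrisTay -/
@[route_item "route-Langlands-EvenArtinQuantumBoundary", crux]
def OffEvenArtin : Prop :=
  (∀ σ : Literature.NumberTheory.GaloisRepresentations.FramedArtinRep ℚ 2, σ.toGaloisRep.IsIrreducible → (∀ (φ : ℚ →+* ℝ) (c : Field.absoluteGaloisGroup ℚ), Literature.NumberTheory.GaloisRepresentations.IsComplexConjugation φ c → Matrix.GeneralLinearGroup.det (σ c) = 1) → Literature.NumberTheory.GaloisRepresentations.LFunction.HasEntireContinuation (Literature.NumberTheory.GaloisRepresentations.artinLFunction σ.toArtinRep)) → _root_.Langlands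

/-- item stmt-Langlands-3311 · support · rank 2 · open · by planner
why it might fail: None mathematically: published theorem (Booker2003 Cor. p.1090; BookerKrishnamurthy2011 p.670). Transcription only: IsPiOfArtinRep (a.e. Satake = Frob charpoly) is weaker than printed L(s,ρ)=L(s,π); ramified Euler factors immaterial (poles only on Re s=0, where L(s,ρ) is regular).
sources: Booker2003, paper:doi-10-4007-annals-2003-158-1089 p2 (Theorem, Corollary, p.1090), BookerKrishnamurthy2011, paper:doi-10-1112-s0010437x10005087 p2 (Introduction, p.670), Literature.NumberTheory.Automorphic.booker_strongArtin_of_artinConjecture, Literature.NumberTheory.Automorphic.strongArtin_of_isSolvable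
[crux] NAMED FACT WANTED (Booker2003, Corollary p. 1090; Theorem: a pole of one Dirichlet twist
forces infinitely many poles of L(s,ρ); with Weil's GL(2) converse theorem: L(s,ρ) entire for a
SINGLE irreducible ρ : Γ_ℚ → GL₂(ℂ) ⟹ ρ automorphic; non-icosahedral types by Langlands–Tunnell =
tree strongArtin_of_isSolvable). Stated with the tree's finite-part Artin L-function and
IsPiOfArtinRep. PROVERS: do not attempt a proof (Annals-length analytic argument + converse theorem
+ Langlands–Tunnell); GROUNDER: vendor as a Literature named fact (cite item filed by the planner)
and re-file this crux as `(h : fact) →` or close it by citation. Placed at rank 2 because the whole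
line rests on it (plancard rule: unproved named fact = first crux). [difficulty: provable-now as a
citation, XL as a proof] -/
@[route_item "route-Langlands-EvenArtinQuantumBoundary"]
def BookerCriterion : Prop :=
  ∀ σ : Literature.NumberTheory.GaloisRepresentations.FramedArtinRep ℚ 2, σ.toGaloisRep.IsIrreducible → Literature.NumberTheory.GaloisRepresentations.LFunction.HasEntireContinuation (Literature.NumberTheory.GaloisRepresentations.artinLFunction σ.toArtinRep) → ∃ (hcpt : Literature.NumberTheory.Automorphic.isCompact_glFiniteIntegralLevel 2 ℚ) (P : Literature.NumberTheory.Automorphic.CuspidalAutomorphicRepData 2 ℚ hcpt), (∀ᶠ v : IsDedekindDomain.HeightOneSpectrum (NumberField.RingOfIntegers ℚ) in Filter.cofinite, ∃ α : Multiset ℂ, Literature.NumberTheory.Automorphic.AutomorphicRepData.HasSatakeParamAt P.1 v α ∧ Literature.NumberTheory.GaloisRepresentations.FramedGaloisRep.IsUnramifiedAt v σ ∧ Literature.NumberTheory.GaloisRepresentations.FramedGaloisRep.HasFrobCharpolyAt v (Literature.NumberTheory.Automorphic.satakePolynomial α) σ)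

-- earlier EvenArtinSectorGlue (stmt-Langlands-14231, replaced 2026-08-16T03:22:49Z -> stmt-Langlands-14408): retired by None — BookerCriterion → QuantumRigidity → GaloisBoundaryBounded → ArtinDirichletCoefficients → EvenStrongArtin
/-- item stmt-Langlands-14408 · support · rank 9 · open · by planner
sources: Booker2003, paper:doi-10-4007-annals-2003-158-1089 p2 (Corollary p.1090)
[support] SECTOR GLUE (pure logic; provable now — term `evenStrongArtin_of` in the planner's
Sketch.lean, lean rc 0): BookerCriterion → QuantumRigidity → GaloisBoundaryBounded →
ArtinDirichletCoefficients → EvenStrongArtin, with the fourth antecedent written out (it IS the body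
of ArtinDirichletCoefficients, inlined only so that the rendered file has no forward reference;
`rfl` with the named form). Proof: for σ irreducible even take a, b for σ and σ^∨ = FramedRep.dual σ
(again a FramedArtinRep ℚ 2 definitionally), (c, B) from GaloisBoundaryBounded, entire continuation
from QuantumRigidity, π from BookerCriterion. Filed at the route-choice edit 2026-08-16 so that the
Target is concluded by an item and the even-Artin sector milestone is a named, bankable statement;
in content `closes` = OffEvenArtin ∘ EvenArtinSectorGlue. [deps: BookerCriterion, QuantumRigidity,
GaloisBoundaryBounded, ArtinDirichletCoefficients, EvenStrongArtin] [difficulty: provable-now, S] -/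
@[route_item "route-Langlands-EvenArtinQuantumBoundary"]
def EvenArtinSectorGlue : Prop :=
  BookerCriterion → QuantumRigidity → GaloisBoundaryBounded → (∀ σ : Literature.NumberTheory.GaloisRepresentations.FramedArtinRep ℚ 2, ∃ a : ℕ → ℂ, (∀ n : ℕ, ‖a n‖ ≤ (Nat.divisors n).card) ∧ ∀ s : ℂ, 1 < s.re → LSeries a s = Literature.NumberTheory.GaloisRepresentations.artinLFunction σ.toArtinRep s) → EvenStrongArtin

/-- item stmt-Langlands-3314 · support · rank 9 · closed · proved by Summit.Langlands.Langlands.Theorems.EvenArtinQuantumBoundaryArtinDirichletCoefficients.artinDirichletCoefficients (prover) · by planner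
sources: Literature.NumberTheory.GaloisRepresentations.FramedArtinRep.hasProd_eulerEval
[support] Dirichlet coefficients of a 2-dimensional Artin L-function over ℚ: there is a : ℕ → ℂ with
|a_n| ≤ d(n) and LSeries a = artinLFunction σ on Re s > 1 (expand the Euler product of inverse
quadratic/linear polynomials with unimodular roots; tree: FramedArtinRep.hasProd_eulerEval,
multipliable_artinLFunction). Routine; needed by the Assembly to instantiate a, b. [difficulty: M,
provable-now] -/
@[route_item "route-Langlands-EvenArtinQuantumBoundary"]
def ArtinDirichletCoefficients : Prop :=
  ∀ σ : Literature.NumberTheory.GaloisRepresentations.FramedArtinRep ℚ 2, ∃ a : ℕ → ℂ, (∀ n : ℕ, ‖a n‖ ≤ (Nat.divisors n).card) ∧ ∀ s : ℂ, 1 < s.re → LSeries a s = Literature.NumberTheory.GaloisRepresentations.artinLFunction σ.toArtinRep s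

-- `ArtinDirichletCoefficients` holds: proved by `Summit.Langlands.Langlands.Theorems.EvenArtinQuantumBoundaryArtinDirichletCoefficients.artinDirichletCoefficients` (its module imports this route file, so no `_holds` link can be stated here).

/-- item stmt-Langlands-3315 · support · rank 9 · open · by planner
sources: LewisZagier2001, BruggemanLewisZagier2015, Bruggeman2006, Zagier2010QMF, Booker2003
[support] NECESSITY OF BB (automorphic ⟹ quantum): if the irreducible even σ is automorphic (∃ π,
IsPiOfArtinRep σ π) then for some c with |c| = N^{-1/2} the formal boundary function B of
QuantumRigidity/GaloisBoundaryBounded is locally bounded on ℚ_{>0}. Known-type chain: π ⟹ Maass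
newform u of eigenvalue 1/4, level N = artinConductorNat, L(s,u) = L(s,σ) exactly (a.e. agreement +
both FEs ⟹ all local factors agree), u|W_N = η ũ; ψ_N(z) = ∫ between the cusps 0 and ∞ of the
Green's form [u, R_z] is holomorphic on ℂ∖(−∞,0] (LewisZagier2001 Ch. II argument, level-N Fricke
pair; BruggemanLewisZagier2015; Zagier2010QMF (13)–(14)); radial limits of ψ_N at rationals exist
and equal B (Bruggeman2006 quantum Maass forms; all twists entire ⟹ asymptotic expansions,
Wilton-type bounds control the horizontal drift of −1/(Nz)); a real-analytic function is bounded on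
compacts. Filing it makes a certified numerical refutation of GaloisBoundaryBounded refute
EvenStrongArtin for that σ. [difficulty: L] -/
@[route_item "route-Langlands-EvenArtinQuantumBoundary"]
def BoundaryNecessity : Prop :=
  ∀ (σ : Literature.NumberTheory.GaloisRepresentations.FramedArtinRep ℚ 2) (a b : ℕ → ℂ), σ.toGaloisRep.IsIrreducible → (∀ (φ : ℚ →+* ℝ) (c : Field.absoluteGaloisGroup ℚ), Literature.NumberTheory.GaloisRepresentations.IsComplexConjugation φ c → Matrix.GeneralLinearGroup.det (σ c) = 1) → (∀ s : ℂ, 1 < s.re → LSeries a s = Literature.NumberTheory.GaloisRepresentations.artinLFunction σ.toArtinRep s) → (∀ s : ℂ, 1 < s.re → LSeries b s = Literature.NumberTheory.GaloisRepresentations.artinLFunction (Literature.NumberTheory.GaloisRepresentations.FramedArtinRep.toArtinRep (Literature.NumberTheory.GaloisRepresentations.FramedRep.dual σ)) s) → (∃ (hcpt : Literature.NumberTheory.Automorphic.isCompact_glFiniteIntegralLevel 2 ℚ) (P : Literature.NumberTheory.Automorphic.CuspidalAutomorphicRepData 2 ℚ hcpt), (∀ᶠ v : IsDedekindDomain.HeightOneSpectrum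 (NumberField.RingOfIntegers ℚ) in Filter.cofinite, ∃ α : Multiset ℂ, Literature.NumberTheory.Automorphic.AutomorphicRepData.HasSatakeParamAt P.1 v α ∧ Literature.NumberTheory.GaloisRepresentations.FramedGaloisRep.IsUnramifiedAt v σ ∧ Literature.NumberTheory.GaloisRepresentations.FramedGaloisRep.HasFrobCharpolyAt v (Literature.NumberTheory.Automorphic.satakePolynomial α) σ)) → ∃ (c : ℂ) (B : ℚ → ℂ), ‖c‖ = ((Literature.NumberTheory.GaloisRepresentations.GaloisRep.artinConductorNat σ.toGaloisRep : ℕ) : ℝ) ^ (-(1 / 2 : ℝ)) ∧ (∀ x : ℚ, 0 < x → ∃ u v : ℂ, (∃ D : ℂ → ℂ, MeromorphicOn D Set.univ ∧ AnalyticAt ℂ D 0 ∧ D 0 = u ∧ ∀ s : ℂ, 1 < s.re → D s = LSeries (fun n : ℕ => a n * Complex.exp (2 * Real.pi * Complex.I * (n : ℂ) * ((x : ℚ) : ℂ))) s) ∧ (∃ D : ℂ → ℂ, MeromorphicOn D Set.univ ∧ AnalyticAt ℂ D 0 ∧ D 0 = v ∧ ∀ s : ℂ, 1 < s.re → D s =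 LSeries (fun n : ℕ => b n * Complex.exp (2 * Real.pi * Complex.I * (n : ℂ) * (((-1 / ((Literature.NumberTheory.GaloisRepresentations.GaloisRep.artinConductorNat σ.toGaloisRep : ℕ) * x)) : ℚ) : ℂ))) s) ∧ B x = u - c * ((x : ℚ) : ℂ)⁻¹ * v) ∧ (∀ m : ℕ, ∃ M : ℝ, ∀ x : ℚ, (1 : ℚ) / (m + 2) ≤ x → x ≤ m + 2 → ‖B x‖ ≤ M)

/-- item stmt-Langlands-3316 · support · rank 9 · open · by planner
sources: Siegel1969, Klingen1962, Shintani1976, DeligneRibet1980, Booker2003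
[support] GALOIS-COMPUTABILITY (card Q2): for irreducible even σ, every rational x and k ∈ ℕ, the
regularised value D_a(−k;x) of the additive twist Σ a_n e(nx) n^{-s} at s = −k exists and is an
algebraic number. Known chain: D_a(s;x) = Σ over Dirichlet characters of Gauss-sum coefficients ×
L(s,σ⊗χ*) × polynomials in p^{-s} (Booker2003 Lemma 1 proof); L(−k,σ⊗χ*) is 0 or algebraic by
CENTRAL Brauer induction (every character of G = im σ is a ℤ-combination of inductions of linear
characters of subgroups H ∋ σ(c), since σ(c) = ±I is central and nilpotent groups are monomial
through central subgroups) reducing to Hecke L-values of totally real fields with characters of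
constant parity, then Siegel1969/Klingen1962/Shintani1976 (and DeligneRibet1980 for integrality, not
claimed here). Aut(ℂ)-equivariance and p-adic interpolation are true refinements left out of the
signature. [difficulty: L] -/
@[route_item "route-Langlands-EvenArtinQuantumBoundary"]
def BoundaryValuesAlgebraic : Prop :=
  ∀ (σ : Literature.NumberTheory.GaloisRepresentations.FramedArtinRep ℚ 2) (a : ℕ → ℂ), σ.toGaloisRep.IsIrreducible → (∀ (φ : ℚ →+* ℝ) (c : Field.absoluteGaloisGroup ℚ), Literature.NumberTheory.GaloisRepresentations.IsComplexConjugation φ c → Matrix.GeneralLinearGroup.det (σ c) = 1) → (∀ s : ℂ, 1 < s.re → LSeries a s = Literature.NumberTheory.GaloisRepresentations.artinLFunction σ.toArtinRep s) → ∀ (x : ℚ) (k : ℕ), ∃ v : ℂ, (∃ D : ℂ → ℂ, MeromorphicOn D Set.univ ∧ AnalyticAt ℂ D (-(k : ℂ)) ∧ D (-(k : ℂ)) = v ∧ ∀ s : ℂ, 1 < s.re → D s = LSeries (fun n : ℕ => a n * Complex.exp (2 * Real.pi * Complex.I * (n : ℂ) * ((x : ℚ) : ℂ))) s) ∧ IsAlgebraic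 ℚ v

-- earlier Assembly (stmt-Langlands-3318, replaced 2026-08-16T04:28:04Z -> stmt-Langlands-14674): retired by None — BookerCriterion → QuantumRigidity → GaloisBoundaryBounded → ArtinDirichletCoefficients → OffEvenArtin → _root_.Langlands
/-- item stmt-Langlands-14674 · assembly · rank 1 · open · by planner
[assembly] QuantumRigidity → GaloisBoundaryBounded → OffEvenArtin → Langlands — the deciding theorem
`closes` as a Prop (crux-only since 2026-08-16: the Dirichlet coefficient sequences a, b are
instantiated inside the proof from the proved Literature theorem
FramedArtinRep.exists_LSeries_eq_artinLFunction_two for σ and σ^∨ = FramedRep.dual σ, and Booker's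
converse step lives inside the complement crux OffEvenArtin). Glue only (modus ponens); the
mathematical content sits in the antecedents. Intermediate milestones: Artin holomorphy on the slice
(QuantumRigidity ∘ GaloisBoundaryBounded) and, through the support items BookerCriterion and
EvenArtinSectorGlue, the Target EvenStrongArtin. -/
@[route_item "route-Langlands-EvenArtinQuantumBoundary"]
def Assembly : Prop :=
  QuantumRigidity → GaloisBoundaryBounded → OffEvenArtin → _root_.Langlands

/-! D-0027 §2.1 — DECIDING THEOREM (planner-authored via `route open/edit --closes-file`; by planner-rchoice-Langlands-EvenArtinQuantumBoun-a85ab51b-g5-0 2026-08-16T04:56:05Z):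
its hypotheses are this route's items and its conclusion the sub-problem Statement (glue_lint), and it elaborates with this file. -/

/-- DECIDING THEOREM (D-0027 §2.1, crux-only). The route's three cruxes decide the summit statement:
GaloisBoundaryBounded (for every irreducible even `σ` some admissible `c` makes the formal boundary
function `B` locally bounded) feeds QuantumRigidity (such a bounded `B` ⟹ `L(s,σ)` entire), the
Dirichlet coefficient sequences `a` of `σ` and `b` of `σ^∨ = FramedRep.dual σ` (again a
`FramedArtinRep ℚ 2` definitionally) being supplied INSIDE the proof by the proved Literature theorem
`FramedArtinRep.exists_LSeries_eq_artinLFunction_two` (Deligne–Serre 1974 §9); this is Artin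
holomorphy on the even two-dimensional slice over `ℚ`, the antecedent of the complement crux
`OffEvenArtin` (Booker's converse step on the slice + the all-places upgrade + GL_n reciprocity in
every other sector — the route's last-ranked crux), which carries it to `Langlands`.
Pure logic; the mathematics sits in the three hypotheses. -/
@[closes "route-Langlands-EvenArtinQuantumBoundary"] theorem closes (hQR : QuantumRigidity) (hBB : GaloisBoundaryBounded) (hOff : OffEvenArtin) :
    _root_.Langlands := by
  refine hOff ?_
  intro σ hirr heven
  obtain ⟨a, -, -, -, -, ha⟩ :=
    Literature.NumberTheory.GaloisRepresentations.FramedArtinRep.exists_LSeries_eq_artinLFunction_two σ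
  obtain ⟨b, -, -, -, -, hb⟩ :=
    Literature.NumberTheory.GaloisRepresentations.FramedArtinRep.exists_LSeries_eq_artinLFunction_two
      (Literature.NumberTheory.GaloisRepresentations.FramedRep.dual σ)
  obtain ⟨c, B, hc, hBdef, hbound⟩ :=
    hBB σ a b hirr heven (fun s hs => (ha s hs).2) (fun s hs => (hb s hs).2)
  exact hQR σ a b c B hirr heven (fun s hs => (ha s hs).2) (fun s hs => (hb s hs).2) hc hBdef hbound

end Summit.Langlands.Langlands.Theses.EvenArtinQuantumBoundary
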